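import Summits.ValiantsHypothesis.ValiantsHypothesis.Theorems.DivisionGapPerDivisionHardStubBlockArsenal

/-!
# Crux `DivisionGap.PerDivisionHard` (stmt-ValiantsHypothesis-5065), line
`pair-descent-jss-endpoint` — stub `stub_blockSubstFacePer`: the phase projection of the placed
face permanent IS `per_b`

`aeval (blockSubst eR eC) (facePer (placedBlock eR eC)) = perPoly (Fin b) ℝ≥0`.

`aeval_blockSubst_facePer` (`…StubBlockArsenal.lean`) writes the image as
`Σ_{σ inside the placed face} ∏_i X (i, phaseMap (rowMatching eR eC σ) i)`; phase maps are
bijections (`phaseMap_bijective_of_adj`) and every permutation is one (`canonMatch`).  New here is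
UNIQUENESS (`apply_eq_canonMatch`): a perfect matching `g` of `G(b,k) ⊕ M₀` is the canonical
matching of its phase map — core rows by `core_row_of_adj`, used paths by `path_of_adj`, an
UNUSED path `(i, j)` (`j ≠ phaseMap g i`) is forced onto its straight phase
row `(i,j,t)` ↦ col `(i,j,t)` column by column (`unused_path_of_adj`: column `(i,j,0)` is adjacent
only to core row `i` and internal row `(i,j,0)`, column `(i,j,t+1)` only to internal rows `(i,j,t)`
and `(i,j,t+1)`, and `g` is onto), padding rows by `blockAdj` (`padding_of_adj`).  Hence
`ρ ↦` (the permutation of `Fin n` placed from `canonMatch ρ⁻¹`) is a bijection from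
`Perm (Fin b)` onto the permutations inside the placed face taking `x^{μ_ρ}` to the corresponding
summand
(`Finset.sum_bij`, `prod_X_eq_monomial`, `sum_single_symm_eq_permMonomial`,
`perPoly_eq_sum_monomial`).
-/

noncomputable section

-- `Summit.ValiantsHypothesis.ValiantsHypothesis.…` is the tree's mandated single-conjunct layout
-- (Sub = Summit), so the duplicated namespace component is intended.
set_option linter.dupNamespace false

namespace Summit.ValiantsHypothesis.ValiantsHypothesis.Theorems.DivisionGapPerDivisionHard

open MvPolynomial Literature.Computability.AlgebraicComplexity
open scoped NNReal

variable {b k m : ℕ}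

/-! ### Uniqueness: a perfect matching of `G(b,k) ⊕ M₀` is determined by its phase map -/

section RowMatching

variable {g : BlockV b k m ≃ BlockV b k m}

/-- **The unused phase of a path.**  If core row `i` is not matched into the path `(i, j)`
(`j ≠ phaseMap g i`), then every internal row `(i, j, t)` is matched straight to the internal
column `(i, j, t)`: column `(i, j, 0)` is adjacent only to core row `i` and internal row
`(i, j, 0)`, column `(i, j, t+1)` only to internal rows `(i, j, t)` and `(i, j, t+1)`, and `g` is
onto. [folklore] -/
theorem unused_path_of_adj (hg : ∀ r, blockAdj b k m r (g r) = true) {i j : Fin b}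
    (hj : j ≠ phaseMap g i) (t : ℕ) (ht : t < k) :
    g (Sum.inr (Sum.inl (i, j, ⟨t, ht⟩))) = Sum.inr (Sum.inl (i, j, ⟨t, ht⟩)) := by
  induction t with
  | zero =>
    obtain ⟨r, hr⟩ := g.surjective (Sum.inr (Sum.inl (i, j, ⟨0, ht⟩)))
    have h := hg r
    rw [hr] at h
    rcases r with i' | ⟨i', j', t'⟩ | u
    · -- the core row `i'`: then `i' = i` and `phaseMap g i = j`
      simp only [blockAdj, decide_eq_true_eq] at h
      obtain ⟨rfl, -⟩ := h
      refine absurd ?_ hj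
      simp [phaseMap, hr, phaseIdx]
    · simp only [blockAdj, decide_eq_true_eq] at h
      obtain ⟨rfl, rfl, ht'⟩ := h
      have ht'' : t' = ⟨0, ht⟩ := Fin.ext (show (t' : ℕ) = 0 by omega)
      subst ht''
      exact hr
    · simp [blockAdj] at h
  | succ t ih =>
    obtain ⟨r, hr⟩ := g.surjective (Sum.inr (Sum.inl (i, j, ⟨t + 1, ht⟩)))
    have h := hg r
    rw [hr] at h
    rcases r with i' | ⟨i', j', t'⟩ | u
    · simp [blockAdj] at h
    · simp only [blockAdj, decide_eq_true_eq] at h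
      obtain ⟨rfl, rfl, ht' | ht'⟩ := h
      · have ht'' : t' = ⟨t + 1, ht⟩ := Fin.ext (show (t' : ℕ) = t + 1 by omega)
        subst ht''
        exact hr
      · -- `g` would send row `(i, j, t)` to both column `(i, j, t)` and column `(i, j, t+1)`
        exfalso
        have ht'' : t' = ⟨t, Nat.lt_of_succ_lt ht⟩ := Fin.ext (show (t' : ℕ) = t by omega)
        subst ht''
        have := (ih (by omega)).symm.trans hr
        simp at this
    · simp [blockAdj] at h

/-- A padding row is matched to its own padding column. [folklore] -/
theorem padding_of_adj (hg : ∀ r, blockAdj b k m r (g r) = true) (u : Fin m) :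
    g (Sum.inr (Sum.inr u)) = Sum.inr (Sum.inr u) := by
  have h := hg (Sum.inr (Sum.inr u))
  generalize g (Sum.inr (Sum.inr u)) = ℓ at h ⊢
  rcases ℓ with j | ⟨i, j, t⟩ | u'
  · simp [blockAdj] at h
  · simp [blockAdj] at h
  · simp only [blockAdj, decide_eq_true_eq] at h
    rw [h]

/-- **A perfect matching of `G(b,k) ⊕ M₀` is determined by its phase map**: it is the canonical
matching `canonMatch ρ` of its phase map `ρ` (core rows by `core_row_of_adj`, used paths by
`path_of_adj`, unused paths by `unused_path_of_adj`, padding by `padding_of_adj`). [folklore] -/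
theorem apply_eq_canonMatch (hg : ∀ r, blockAdj b k m r (g r) = true) (ρ : Equiv.Perm (Fin b))
    (hρ : ∀ i, ρ i = phaseMap g i) (r : BlockV b k m) : g r = canonMatch ρ r := by
  rcases r with i | ⟨i, j, t⟩ | u
  · rcases core_row_of_adj hg i with ⟨hk, h⟩ | ⟨hk, h⟩
    · have hk' : ¬0 < k := by omega
      rw [h]
      simp [canonMatch, hk', hρ]
    · rw [h]
      simp [canonMatch, hk, hρ]
  · by_cases hj : j = ρ i
    · rcases core_row_of_adj hg i with ⟨hk, -⟩ | ⟨hk, h0⟩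
      · exfalso
        have := t.2
        omega
      · rw [← hρ i, ← hj] at h0
        have := path_of_adj hg h0 t t.2
        simp only [canonMatch, if_pos hj]
        exact this
    · have hj' : j ≠ phaseMap g i := fun h => hj (h.trans (hρ i).symm)
      simp only [canonMatch, if_neg hj]
      exact unused_path_of_adj hg hj' t t.2
  · exact padding_of_adj hg u

end RowMatching

/-! ### The placed canonical matchings -/

/-- The phase map of the canonical matching `canonMatch ρ` is `ρ`. [folklore] -/
theorem phaseMap_ofBijective_canonMatch (ρ : Equiv.Perm (Fin b)) :
    phaseMap (Equiv.ofBijective (canonMatch (k := k) (m := m) ρ) (canonMatch_bijective ρ)) =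
      ρ := by
  funext i
  simp only [phaseMap, Equiv.ofBijective_apply, canonMatch]
  by_cases hk : 0 < k
  · simp [hk, phaseIdx]
  · simp [hk, phaseIdx]

variable {n : ℕ}

/-- The row matching of the permutation of `Fin n` placed from a matching `G` (rows ↦ columns)
is `G`. [folklore] -/
theorem rowMatching_placed (eR eC : BlockV b k m ≃ Fin n) (G : BlockV b k m ≃ BlockV b k m) :
    rowMatching eR eC (eC.symm.trans (G.symm.trans eR)) = G := by
  ext r
  simp [rowMatching]

/-! ### The stub -/

/-- **stub_blockSubstFacePer.**  The phase projection of the placed face permanent IS the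
permanent: `aeval (blockSubst eR eC) (facePer (placedBlock eR eC)) = per_b` — the placed
canonical matchings `ρ ↦ σ_ρ` (from `canonMatch ρ⁻¹`) biject `Perm (Fin b)` onto the permutations
inside the placed face (onto by uniqueness `apply_eq_canonMatch`, one-to-one by
`phaseMap (canonMatch π) = π`), and `σ_ρ`'s summand `∏_i X (i, ρ⁻¹ i)` is `x^{μ_ρ}`
(`sum_single_symm_eq_permMonomial`, `perPoly_eq_sum_monomial`). [folklore] -/
theorem stub_blockSubstFacePer :
    ∀ (b k m n : ℕ) (eR eC : BlockV b k m ≃ Fin n),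
      aeval (blockSubst eR eC) (facePer (placedBlock eR eC)) = perPoly (Fin b) ℝ≥0 := by
  intro b k m n eR eC
  rw [aeval_blockSubst_facePer, perPoly_eq_sum_monomial]
  symm
  refine Finset.sum_bij
    (fun ρ _ => eC.symm.trans
      ((Equiv.ofBijective (canonMatch ρ.symm) (canonMatch_bijective ρ.symm)).symm.trans eR))
    ?_ ?_ ?_ ?_
  · -- the placed permutation lies inside the placed face
    intro ρ _
    simp only [Finset.mem_filter, Finset.mem_univ, true_and, placedBlock, Equiv.trans_apply,
      Equiv.symm_apply_apply]
    intro x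
    have := blockAdj_canonMatch ρ.symm
      ((Equiv.ofBijective (canonMatch ρ.symm)
        (canonMatch_bijective (k := k) (m := m) ρ.symm)).symm (eC.symm x))
    rwa [Equiv.ofBijective_apply_symm_apply (canonMatch ρ.symm) (canonMatch_bijective ρ.symm)]
      at this
  · -- one-to-one: the phase map of the placed canonical matching recovers `ρ⁻¹`
    intro ρ₁ _ ρ₂ _ h
    have h' := congrArg (fun σ => phaseMap (rowMatching eR eC σ)) h
    simp only [rowMatching_placed, phaseMap_ofBijective_canonMatch] at h'
    simpa using congrArg Equiv.symm (Equiv.coe_fn_injective h')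
  · -- onto: a permutation inside the placed face is the placed canonical matching of its phase map
    intro σ hσ
    simp only [Finset.mem_filter, Finset.mem_univ, true_and] at hσ
    have hg : ∀ r, blockAdj b k m r (rowMatching eR eC σ r) = true := adj_rowMatching hσ
    obtain ⟨π, hπ⟩ :
        ∃ π : Equiv.Perm (Fin b), ∀ i, π i = phaseMap (rowMatching eR eC σ) i :=
      ⟨Equiv.ofBijective _ (phaseMap_bijective_of_adj hg), fun _ => rfl⟩
    have key : ∀ r, rowMatching eR eC σ r = canonMatch π r := apply_eq_canonMatch hg π hπ
    refine ⟨π.symm, Finset.mem_univ _, ?_⟩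
    change eC.symm.trans
      ((Equiv.ofBijective (canonMatch π) (canonMatch_bijective π)).symm.trans eR) = σ
    refine Equiv.ext fun x => ?_
    simp only [Equiv.trans_apply]
    rw [Equiv.apply_eq_iff_eq_symm_apply, Equiv.symm_apply_eq, Equiv.ofBijective_apply, ← key]
    simp [rowMatching]
  · -- the summands agree
    intro ρ _
    rw [rowMatching_placed, phaseMap_ofBijective_canonMatch, prod_X_eq_monomial,
      sum_single_symm_eq_permMonomial]

end Summit.ValiantsHypothesis.ValiantsHypothesis.Theorems.DivisionGapPerDivisionHard

end
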